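import Literature.NumberTheory.Automorphic.RankinSelbergLocalLFactor
import Literature.NumberTheory.Automorphic.GodementJacquetLocalNonvanishing
import HarnessLib

/-!
# The local Godement–Jacquet `L`-factor: reduction of Thm. 3.3 (2) to the common denominator

Trunk `AutomorphicAxiomatic` (G19), topic `NumberTheory/Automorphic`; proof file (theorems and one
bookkeeping definition) on top of `GodementJacquetLocal` (the predicate `HasGJLFactor ρ μG P`,
"`L(s, π) = P(q^{-s})⁻¹` generates the fractional ideal of the zeta integrals
`Z(Φ, s + (n-1)/2, f)`", and the named fact
`GodementJacquet1972_local_existsUnique_hasGJLFactor` = Godement–Jacquet, LNM 260 (1972),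
Thm. 3.3 (2), in the form `∃! P, HasGJLFactor ρ μG P` for every irreducible admissible `π` and
every Haar measure `μG` on `GL_n(F)`).

The printed proof of Thm. 3.3 (2) has three ingredients:

1. (analysis) every zeta integral converges for `re s ≫ 0` and is there a rational function of
   `q^{-s}` — and all of them admit a **common denominator** (LNM 260, Ch. I: first for an
   absolutely cuspidal `π`, whose coefficients are compactly supported modulo the centre, then
   for the constituents of representations induced from those, i.e. for every irreducible
   admissible `π`; Jacquet, Corvallis (1979), Part 2, Prop. (1.2) (1)–(2));
2. (non-vanishing) the span `I(π)` of the zeta integrals contains the constants: for `Φ` the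
   characteristic function of a small compact open subgroup and `f(1) ≠ 0`, `Z(Φ, s, f)` is a
   non-zero constant — **proved** in `GodementJacquetLocalNonvanishing`
   (`exists_coeff_gjLocalZeta_eq_const`);
3. (algebra) `I(π)` is a `ℂ[q^{-s}, q^{s}]`-submodule of `P₀(q^{-s})⁻¹ ℂ[q^{-s}, q^{s}]` containing
   `1`, and `ℂ[T]` is a principal ideal domain, so `I(π) = P(q^{-s})⁻¹ ℂ[q^{-s}, q^{s}]` for a unique
   `P` with `P(0) = 1` — **proved** abstractly in `RankinSelbergLocalLFactor`
   (`exists_isLGenerator`, `IsLGenerator.unique`, for any family of functions `Z : ι → ℂ → ℂ`).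

This file assembles 2 and 3 for the Godement–Jacquet family and isolates 1 as the only
remaining input, in the literal shape of clause (a) of `HasGJLFactor`:

* `gjZetaFamily ρ μG` — the family `(Φ, ṽ, v) ↦ (s ↦ Z(Φ, s + (n-1)/2, ⟨π(·) v, ṽ⟩))` over all
  `Φ ∈ 𝒮(M_n(F))`, `ṽ ∈ Ṽ`, `v ∈ V`; `hasGJLFactor_iff_isLGenerator`: `HasGJLFactor ρ μG P` **is**
  `IsLGenerator q (gjZetaFamily ρ μG) P`.
* `inZetaSpan_one_gjZetaFamily`: for `ρ` smooth on `V ≠ 0` and `μG` Haar, `1 ∈ I(π)`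
  (ingredient 2); `ne_zero_of_hasZetaDenominator_gjZetaFamily`: hence a common denominator is
  automatically `≠ 0`.
* `exists_hasGJLFactor_of_hasZetaDenominator`, `existsUnique_hasGJLFactor_of_denominator`,
  `existsUnique_hasGJLFactor_iff_exists_denominator`: **for a smooth representation on a
  non-zero space and a Haar measure, `∃! P, HasGJLFactor ρ μG P` holds iff the zeta integrals
  admit some common denominator `P₀ ∈ ℂ[T]`** (every `Z(Φ, s + (n-1)/2, f)` agrees for `re s ≫ 0`
  with `R(q^{-s}) / P₀(q^{-s})`, `R` Laurent).
* `GodementJacquet1972_local_existsUnique_hasGJLFactor_of_denominators` and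
  `GodementJacquet1972_local_existsUnique_hasGJLFactor_iff_denominators`: the named fact is
  **equivalent** to ingredient 1 quantified over all irreducible admissible `π` and Haar `μG`
  (same binders as the fact). No new named fact is introduced (D-0026): ingredient 1 is a
  hypothesis of these reduction theorems, not a `def`.

## References

* R. Godement, H. Jacquet, *Zeta functions of simple algebras*, LNM 260 (1972), §3, Thm. 3.3
  and its proof ("the integrals span a fractional ideal containing the constants")
  [GodementJacquet1972] (not held on this hub; architecture as restated in the two sources below
  and in Cogdell's survey cited in `RankinSelbergLocalLFactor`).
* H. Jacquet, *Principal `L`-functions of the linear group*, Proc. Sympos. Pure Math. 33 (1979),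
  Part 2, §1, Prop. (1.2) and its proof [JacquetCorvallis1979].
* S. Gelbart, *Automorphic forms on adele groups*, Ann. of Math. Stud. 83 (1975), §6, p. 83
  (`n = 2`) [Gelbart1975].
-/

set_option autoImplicit false

open scoped MatrixGroups
open Polynomial Matrix MeasureTheory
  Literature.NumberTheory.GaloisRepresentations.IsNonarchimedeanLocalField

noncomputable section

namespace Literature.NumberTheory.Automorphic

/-! ### The Godement–Jacquet family of zeta integrals -/

section Family

variable {F : Type*} [Field F] [ValuativeRel F] [TopologicalSpace F]
  [IsNonarchimedeanLocalField F] {n : ℕ} {V : Type*} [AddCommGroup V] [Module ℂ V]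
  [MeasurableSpace (GL (Fin n) F)]
  (ρ : Representation ℂ (GL (Fin n) F) V) (μG : Measure (GL (Fin n) F))

/-- The **Godement–Jacquet family of (shifted) local zeta integrals** of a representation `ρ` of
`GL_n(F)` against the measure `μG`: `(Φ, ṽ, v) ↦ (s ↦ Z(Φ, s + (n-1)/2, f))`,
`f(g) = ⟨ρ(g) v, ṽ⟩ = ρ.matrixCoeff ṽ v g`, indexed by all Schwartz–Bruhat `Φ` on `M_n(F)`, all
`ṽ` in the smooth contragredient `ρ.contragredient` and all `v ∈ V` — the family whose
`ℂ[q^{-s}, q^{s}]`-span is the fractional ideal `I(π)` of Godement–Jacquet (1972), Thm. 3.3, in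
the unitary normalisation of Jacquet (1979), (1.3) used by `HasGJLFactor`.
[cite: GodementJacquet1972, Thm. 3.3] -/
def gjZetaFamily :
    (↥(SchwartzBruhat (Matrix (Fin n) (Fin n) F)) × ↥ρ.contragredient × V) → ℂ → ℂ :=
  fun x s => gjLocalZeta μG ((x.1 : ↥(SchwartzBruhat (Matrix (Fin n) (Fin n) F))) :
      Matrix (Fin n) (Fin n) F → ℂ)
    (ρ.matrixCoeff ((x.2.1 : ↥ρ.contragredient) : Module.Dual ℂ V) x.2.2)
    (s + ((n : ℂ) - 1) / 2)

/-- Unfolding lemma for `gjZetaFamily`. [folklore] -/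
@[simp] theorem gjZetaFamily_apply
    (x : ↥(SchwartzBruhat (Matrix (Fin n) (Fin n) F)) × ↥ρ.contragredient × V) (s : ℂ) :
    gjZetaFamily ρ μG x s = gjLocalZeta μG (x.1 : Matrix (Fin n) (Fin n) F → ℂ)
      (ρ.matrixCoeff (x.2.1 : Module.Dual ℂ V) x.2.2) (s + ((n : ℂ) - 1) / 2) :=
  rfl

/-- **`HasGJLFactor` is the normalised-generator predicate** of the Godement–Jacquet family:
`HasGJLFactor ρ μG P ↔ IsLGenerator q (gjZetaFamily ρ μG) P` — clause (a) of `HasGJLFactor` is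
`HasZetaDenominator`, clause (b) is `InZetaSpan _ _ (rsLRat P)` (pure rewriting of the
quantifiers over `(Φ, ṽ, v)`). [folklore] -/
theorem hasGJLFactor_iff_isLGenerator (P : ℂ[X]) :
    HasGJLFactor ρ μG P ↔ IsLGenerator (residueFieldCard F) (gjZetaFamily ρ μG) P := by
  constructor
  · rintro ⟨h0, ha, k, Φ, φ, v, Q, hΦ, hφ, hQ, hE⟩
    refine ⟨h0, ?_, k, fun l => ⟨⟨Φ l, hΦ l⟩, ⟨φ l, hφ l⟩, v l⟩, Q, hQ, hE⟩
    rintro ⟨⟨Φ₁, hΦ₁⟩, ⟨φ₁, hφ₁⟩, v₁⟩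
    exact ha Φ₁ hΦ₁ φ₁ hφ₁ v₁
  · rintro ⟨h0, ha, k, j, Q, hQ, hE⟩
    exact ⟨h0, fun Φ hΦ φ hφ v => ha ⟨⟨Φ, hΦ⟩, ⟨φ, hφ⟩, v⟩, k,
      fun l => ((j l).1 : Matrix (Fin n) (Fin n) F → ℂ),
      fun l => ((j l).2.1 : Module.Dual ℂ V), fun l => (j l).2.2, Q,
      fun l => (j l).1.2, fun l => (j l).2.1.2, hQ, hE⟩

variable {ρ μG}

/-- Clause (a) of `HasGJLFactor`: an `L`-polynomial is a common denominator of the family.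
[folklore] -/
theorem HasGJLFactor.hasZetaDenominator {P : ℂ[X]} (h : HasGJLFactor ρ μG P) :
    HasZetaDenominator (residueFieldCard F) (gjZetaFamily ρ μG) P :=
  ((hasGJLFactor_iff_isLGenerator ρ μG P).mp h).2.1

/-- Clause (b) of `HasGJLFactor`: `P(q^{-s})⁻¹` lies in the span of the family. [folklore] -/
theorem HasGJLFactor.inZetaSpan {P : ℂ[X]} (h : HasGJLFactor ρ μG P) :
    InZetaSpan (residueFieldCard F) (gjZetaFamily ρ μG) (rsLRat P) :=
  ((hasGJLFactor_iff_isLGenerator ρ μG P).mp h).2.2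

/-- **`1 ∈ I(π)`** (Godement–Jacquet (1972), §3, proof of Thm. 3.3; Jacquet (1979), proof of
Prop. (1.2)): for a smooth representation `ρ` of `GL_n(F)` on `V ≠ 0` and a Haar measure `μG`,
the constant `1` is a (one-term) Laurent combination of zeta integrals of the family: by
`exists_coeff_gjLocalZeta_eq_const` some `Z(Φ, s, ⟨ρ(·) v, ṽ⟩)` is a non-zero constant `c` for
all `s`, and `c⁻¹ · Z = 1`. [cite: GodementJacquet1972, §3 (proof of Thm. 3.3)] -/
theorem inZetaSpan_one_gjZetaFamily [BorelSpace (GL (Fin n) F)] [μG.IsHaarMeasure]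
    (hρ : ρ.IsSmooth) [Nontrivial V] :
    InZetaSpan (residueFieldCard F) (gjZetaFamily ρ μG) 1 := by
  obtain ⟨v, lam, hlam, Φ, hΦ, c, hc, h⟩ := exists_coeff_gjLocalZeta_eq_const μG ρ hρ
  have h2 : ∀ s, gjLocalZeta μG Φ (ρ.matrixCoeff lam v) s = c := fun s => (h s).2
  refine ⟨1, fun _ => ⟨⟨Φ, hΦ⟩, ⟨lam, hlam⟩, v⟩, fun _ => RatFunc.C c⁻¹, fun _ => ?_, 0,
    fun s _ => ?_⟩
  · simpa [RatFunc.algebraMap_C] using isLaurent_algebraMap (Polynomial.C c⁻¹)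
  · simp only [Fin.sum_univ_one, gjZetaFamily_apply, h2]
    rw [evalAtQ, evalAtQ, RatFunc.eval_C, RatFunc.eval_one, RingHom.id_apply,
      inv_mul_cancel₀ hc]

/-- A common denominator of the Godement–Jacquet family of a smooth representation on `V ≠ 0`
(Haar measure) is non-zero: otherwise every zeta integral would vanish for `re s ≫ 0`,
contradicting `exists_coeff_gjLocalZeta_eq_const`. [folklore] -/
theorem ne_zero_of_hasZetaDenominator_gjZetaFamily [BorelSpace (GL (Fin n) F)]
    [μG.IsHaarMeasure] (hρ : ρ.IsSmooth) [Nontrivial V] {P₀ : ℂ[X]}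
    (hden : HasZetaDenominator (residueFieldCard F) (gjZetaFamily ρ μG) P₀) : P₀ ≠ 0 := by
  rintro rfl
  obtain ⟨v, lam, hlam, Φ, hΦ, c, hc, h⟩ := exists_coeff_gjLocalZeta_eq_const μG ρ hρ
  obtain ⟨R, -, c₀, hc₀⟩ := hden ⟨⟨Φ, hΦ⟩, ⟨lam, hlam⟩, v⟩
  have key := hc₀ ((c₀ : ℂ) + 1) (by simp)
  rw [gjZetaFamily_apply] at key
  change gjLocalZeta μG Φ (ρ.matrixCoeff lam v) _ = _ at key
  rw [(h _).2, rsLRat, map_zero, _root_.inv_zero, mul_zero, evalAtQ, RatFunc.eval_zero] at key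
  exact hc key

/-- **Existence of the local `L`-factor from a common denominator** (ingredients 2–3 of the
proof of Godement–Jacquet (1972), Thm. 3.3 (2), assembled): if `ρ` is smooth on `V ≠ 0`, `μG` is
a Haar measure and the family of zeta integrals `Z(Φ, s + (n-1)/2, f)` has a common denominator
`P₀` (each agrees for `re s ≫ 0` with `R(q^{-s})/P₀(q^{-s})`, `R` Laurent), then some `P` with
`P(0) = 1` satisfies `HasGJLFactor ρ μG P` (`exists_isLGenerator` with
`inZetaSpan_one_gjZetaFamily`). [cite: GodementJacquet1972, Thm. 3.3 (2)] -/
theorem exists_hasGJLFactor_of_hasZetaDenominator [BorelSpace (GL (Fin n) F)]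
    [μG.IsHaarMeasure] (hρ : ρ.IsSmooth) [Nontrivial V] {P₀ : ℂ[X]}
    (hden : HasZetaDenominator (residueFieldCard F) (gjZetaFamily ρ μG) P₀) :
    ∃ P : ℂ[X], HasGJLFactor ρ μG P := by
  obtain ⟨P, hP⟩ := exists_isLGenerator (one_lt_residueFieldCard F)
    (ne_zero_of_hasZetaDenominator_gjZetaFamily hρ hden) hden (inZetaSpan_one_gjZetaFamily hρ)
  exact ⟨P, (hasGJLFactor_iff_isLGenerator ρ μG P).mpr hP⟩

/-- **`∃! P, HasGJLFactor ρ μG P` from a common denominator**, hypothesis in the literal shape of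
clause (a) of `HasGJLFactor` with an arbitrary polynomial `P₀` in place of `P`: for `ρ` smooth on
`V ≠ 0` and `μG` Haar, a common denominator of all `Z(Φ, s + (n-1)/2, ⟨ρ(·) v, ṽ⟩)`
(`Φ ∈ 𝒮(M_n(F))`, `ṽ ∈ Ṽ`, `v ∈ V`) yields the unique normalised generator
(`exists_hasGJLFactor_of_hasZetaDenominator` and `HasGJLFactor.unique` of `GodementJacquetLocal`).
This is Thm. 3.3 (2) of Godement–Jacquet (1972) minus its analytic input (convergence and
rationality with a common denominator, loc. cit. (1)–(2); Jacquet (1979), Prop. (1.2) (1)–(2)).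
[cite: GodementJacquet1972, Thm. 3.3 (2)] -/
theorem existsUnique_hasGJLFactor_of_denominator [BorelSpace (GL (Fin n) F)]
    [μG.IsHaarMeasure] (hρ : ρ.IsSmooth) [Nontrivial V] {P₀ : ℂ[X]}
    (hden : ∀ Φ ∈ SchwartzBruhat (Matrix (Fin n) (Fin n) F), ∀ φ ∈ ρ.contragredient, ∀ v : V,
      ∃ R : RatFunc ℂ, IsLaurent R ∧ EqOnRightHalfPlane (residueFieldCard F)
        (fun s => gjLocalZeta μG Φ (ρ.matrixCoeff φ v) (s + ((n : ℂ) - 1) / 2))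
        (R * rsLRat P₀)) :
    ∃! P : ℂ[X], HasGJLFactor ρ μG P := by
  refine existsUnique_hasGJLFactor_of_exists
    (exists_hasGJLFactor_of_hasZetaDenominator (P₀ := P₀) hρ ?_)
  rintro ⟨⟨Φ, hΦ⟩, ⟨φ, hφ⟩, v⟩
  exact hden Φ hΦ φ hφ v

/-- **The local `L`-factor exists iff the zeta integrals have a common denominator**: for `ρ`
smooth on `V ≠ 0` and `μG` a Haar measure on `GL_n(F)`,
`(∃! P, HasGJLFactor ρ μG P) ↔ ∃ P₀, ∀ Φ ṽ v, Z(Φ, s + (n-1)/2, ⟨ρ(·) v, ṽ⟩) ∈ P₀(q^{-s})⁻¹ ℂ[q^{∓s}]`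
for `re s ≫ 0` (forward: `P₀ = P`, clause (a); backward:
`existsUnique_hasGJLFactor_of_denominator`). It exhibits the exact remaining content of
Godement–Jacquet (1972), Thm. 3.3 (2) beyond what is proved in the tree.
[cite: GodementJacquet1972, Thm. 3.3 (2)] -/
theorem existsUnique_hasGJLFactor_iff_exists_denominator [BorelSpace (GL (Fin n) F)]
    [μG.IsHaarMeasure] (hρ : ρ.IsSmooth) [Nontrivial V] :
    (∃! P : ℂ[X], HasGJLFactor ρ μG P) ↔
      ∃ P₀ : ℂ[X], ∀ Φ ∈ SchwartzBruhat (Matrix (Fin n) (Fin n) F), ∀ φ ∈ ρ.contragredient,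
        ∀ v : V, ∃ R : RatFunc ℂ, IsLaurent R ∧ EqOnRightHalfPlane (residueFieldCard F)
          (fun s => gjLocalZeta μG Φ (ρ.matrixCoeff φ v) (s + ((n : ℂ) - 1) / 2))
          (R * rsLRat P₀) := by
  constructor
  · rintro ⟨P, hP, -⟩
    exact ⟨P, hP.2.1⟩
  · rintro ⟨P₀, hden⟩
    exact existsUnique_hasGJLFactor_of_denominator hρ hden

end Family

/-! ### The named fact `GodementJacquet1972_local_existsUnique_hasGJLFactor` and its remaining input -/

section Facts

variable {F : Type} [Field F] [ValuativeRel F] [TopologicalSpace F] [IsNonarchimedeanLocalField F]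
  {n : ℕ}

/-- **Reduction of Godement–Jacquet (1972), Thm. 3.3 (2) to its analytic input.** If for every
Haar measure `μG` on `GL_n(F)` and every irreducible admissible representation `π = (ρ, V)` the
zeta integrals `Z(Φ, s + (n-1)/2, ⟨π(·) v, ṽ⟩)` (`Φ ∈ 𝒮(M_n(F))`, `ṽ ∈ Ṽ`, `v ∈ V`) are, for
`re s ≫ 0`, rational functions of `q^{-s}` with a **common denominator** `P₀(q^{-s})`
(Thm. 3.3 (1) and the first clause of (2); Jacquet (1979), Prop. (1.2) (1)–(2): proved in LNM 260,
Ch. I, first for absolutely cuspidal `π` and then for constituents of representations induced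
from those), then the named fact
`GodementJacquet1972_local_existsUnique_hasGJLFactor` holds: irreducible gives `V ≠ 0`
(`Representation.nontrivial_of_isIrreducible` of `RepresentationTheory/Semisimple/Multiplicity`),
admissible gives smooth, and
`existsUnique_hasGJLFactor_of_denominator` applies. [cite: GodementJacquet1972, Thm. 3.3 (2)] -/
theorem GodementJacquet1972_local_existsUnique_hasGJLFactor_of_denominators
    (hden : ∀ [MeasurableSpace (GL (Fin n) F)] [BorelSpace (GL (Fin n) F)]
      (μG : Measure (GL (Fin n) F)) [μG.IsHaarMeasure] {V : Type} [AddCommGroup V] [Module ℂ V]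
      (ρ : Representation ℂ (GL (Fin n) F) V) [ρ.IsIrreducible] (_hρ : ρ.IsAdmissible),
      ∃ P₀ : ℂ[X], ∀ Φ ∈ SchwartzBruhat (Matrix (Fin n) (Fin n) F), ∀ φ ∈ ρ.contragredient,
        ∀ v : V, ∃ R : RatFunc ℂ, IsLaurent R ∧ EqOnRightHalfPlane (residueFieldCard F)
          (fun s => gjLocalZeta μG Φ (ρ.matrixCoeff φ v) (s + ((n : ℂ) - 1) / 2))
          (R * rsLRat P₀)) :
    GodementJacquet1972_local_existsUnique_hasGJLFactor (F := F) (n := n) := by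
  intro _ _ μG _ V _ _ ρ _ hρ
  haveI : Nontrivial V :=
    Literature.RepresentationTheory.Semisimple.Representation.nontrivial_of_isIrreducible ρ
  obtain ⟨P₀, h⟩ := hden μG ρ hρ
  exact existsUnique_hasGJLFactor_of_denominator hρ.isSmooth h

/-- **The named fact is equivalent to its analytic input**: Godement–Jacquet (1972), Thm. 3.3 (2)
in the tree's form `GodementJacquet1972_local_existsUnique_hasGJLFactor` (`∃! P, HasGJLFactor`)
holds iff for every Haar measure and every irreducible admissible `π` the zeta integrals have a
common denominator for `re s ≫ 0` (forward: the `L`-polynomial itself, clause (a) of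
`HasGJLFactor`; backward: `GodementJacquet1972_local_existsUnique_hasGJLFactor_of_denominators`).
What the tree proves of Thm. 3.3 (2) is thus everything except convergence-and-rationality with a
common denominator (`GodementJacquet1972_local_convergence` records the convergence half as a
named fact). [cite: GodementJacquet1972, Thm. 3.3 (2)] -/
theorem GodementJacquet1972_local_existsUnique_hasGJLFactor_iff_denominators :
    GodementJacquet1972_local_existsUnique_hasGJLFactor (F := F) (n := n) ↔
      ∀ [MeasurableSpace (GL (Fin n) F)] [BorelSpace (GL (Fin n) F)]
        (μG : Measure (GL (Fin n) F)) [μG.IsHaarMeasure] {V : Type} [AddCommGroup V] [Module ℂ V]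
        (ρ : Representation ℂ (GL (Fin n) F) V) [ρ.IsIrreducible] (_hρ : ρ.IsAdmissible),
        ∃ P₀ : ℂ[X], ∀ Φ ∈ SchwartzBruhat (Matrix (Fin n) (Fin n) F), ∀ φ ∈ ρ.contragredient,
          ∀ v : V, ∃ R : RatFunc ℂ, IsLaurent R ∧ EqOnRightHalfPlane (residueFieldCard F)
            (fun s => gjLocalZeta μG Φ (ρ.matrixCoeff φ v) (s + ((n : ℂ) - 1) / 2))
            (R * rsLRat P₀) := by
  constructor
  · intro h _ _ μG _ V _ _ ρ _ hρ
    obtain ⟨P, hP, -⟩ := h μG ρ hρ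
    exact ⟨P, hP.2.1⟩
  · intro h
    exact GodementJacquet1972_local_existsUnique_hasGJLFactor_of_denominators
      (fun μG _ _ _ _ ρ _ hρ => h μG ρ hρ)

end Facts

end Literature.NumberTheory.Automorphic
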